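import Summits.Ventures.CertifiedArithmetic.LowPrec.DoubleRoundingDivisionStrip

/-!
# Double rounding of quotients: the underflow clause is necessary (THEOREM N-div-U)

HONEST FRAMING (venture CertifiedArithmetic / cell `pub-lowprec`): certified error envelopes and
provably optimal rounding/accumulation schemes for low-precision formats under stated cost models;
every table by two implementations; no hardware or vendor claims.

The quotient clause (Q) of `drDiv_of_clause` (`DoubleRoundingDivision.lean`) makes the double
rounding `fl_φ (fl_ψ (a / b))` of `φ`-quotients innocuous under `F_φ ⊆ F_ψ`, `P_ψ ≥ 2 P_φ` and the
UNDERFLOW CLAUSE `L_ψ + P_φ ≤ L_φ` (`L = qexp`, `P = m + 1`): the quantum of `ψ` is at least `P_φ`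
binades finer than that of `φ`.  THEOREM N-div-S (`not_drDiv_of_strip`) shows the precision
condition necessary; `drDiv_underflow_clause_sharp` showed the underflow clause sharp on TWO toy
pairs.  This file proves the underflow clause NECESSARY FOR EVERY PAIR OF RECORDS (§1: with a
quantum of `ψ` only `d ≤ m = m_φ` binades finer some quotient slips — whatever the precision of
`ψ`) and turns the hypotheses into boolean tests on records, evaluated on the named `13 × 13`
matrix (§2).  The record-level DECISION of `DRDiv` that these witnesses complete is
`DoubleRoundingDivisionLaw.lean`.

* §1 THEOREM N-div-U.  (U1) `not_drDiv_of_underflow`: `1 ≤ d = L_φ - L_ψ ≤ m`, `m ≥ 1`, the data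
  `a = 2^i`, `b = (2^(m+1) - 1)·2^c` quanta of `φ` with `i = m + c + L_φ`, and `2^(d-1) ≤ M_ψ`
  `⟹ ¬ DRDiv φ ψ` — NO hypothesis on `P_ψ`, no inclusion: `a / b = 2^m q/(2^(m+1) - 1)
  = (q/2)(1 + 1/(2^(m+1) - 1))` (`q = quantum φ`) exceeds the midpoint `q/2 = 2^(d-1)·quantum ψ` —
  a value of `ψ` — by less than `quantum ψ / 2` (iff `2^d < 2^(m+1) - 1`), so `fl_ψ (a/b) = q/2`
  (integrality of the grid of `ψ`), `fl_φ (q/2) = 0` (tie to even) while `fl_φ (a/b) = q`; for a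
  bias `≥ 1` the data are the least subnormal `q` and `2 - 2^-m`.
  (U0) `not_drDiv_of_underflow_low`: `L_ψ ≤ L_φ`, ANY wider significand `m + 1 ≤ m_ψ`,
  `k + d + 1 ≤ m`: Figueroa's quotient
  `2^n / ((2^(m+1) - 1)·2^c) = (2^(m+1+k) + 2^k)·q + 2^k q/(2^(m+1) - 1)` of THEOREM N-div-S slips,
  because `y = (2^(m+1+k) + 2^k)·q = (2^(m+1) + 1)·2^(k+d)·quantum ψ` is a value of `ψ` and the
  excess is below `quantum ψ / 2` — where N-div-S needed `y` NORMAL in `ψ` and `P_ψ < 2 P_φ`; so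
  the one quotient refutes the whole strip AND every wider precision with `d ≤ m - 1 - k`.
* §2 THE HYPOTHESES AS BOOLEAN TESTS (`drDivUnderflowTest` = U1 at `c = max (0, -(m + L_φ))`,
  `drDivUnderflowLowTest` = U0 at `k = 0`, `c = max (0, -(2m + 2 + L_φ))`) and the named `13 × 13`
  records: U1 holds on exactly `8` cells — the embedded e5m2 → binary8p3f (`d = 1`, also an
  N-div-E cell) and `7` non-embedded pairs (e2m3 → e3m2, e4m3 → binary8p4 / binary8p4f,
  e5m2 → binary8p3, binary8p5 → e4m3 / binary8p4 / binary8p4f), refuted here without any range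
  reasoning; U0 on none (no named pair has a wider significand and `d ≤ m - 1`).

Two implementations: A = `code/enum/div_underflow_law.py` (exact rationals: the U1 / U0 families
on pseudo-records `2 ≤ P_φ ≤ 12`, `P_φ - 1 ≤ P_ψ ≤ 3 P_φ`, two RNE implementations — `920` U1 and
`2860` U0 witnesses slip with the three predicted values; the `13 × 13` named cells) →
`certs/enum/DOUBLE-ROUNDING-DIV-UNDERFLOW.json`; B = the kernel (this file).  PLACEMENT — KNOWN:
innocuous double rounding of quotients for `p₂ ≥ 2p₁` with unbounded exponents, and the optimality
of `2p₁`, are [Figueroa1995, §3; Roux2014, §5.1 Thm. 29 and Rem. 30]; with gradual underflow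
[Roux2014, Table II] proves it (Coq/Flocq, any tie rule) under `emin₂ ≤ emin₁ - p₁ - 2`, and this
packet's clause (Q) (`drDiv_of_clause`) under the weaker `emin₂ ≤ emin₁ - p₁` for the saturating
ties-to-even records, sharp on two toy pairs (`drDiv_underflow_clause_sharp`).  We found no
necessity statement for the `emin` / quantum hypothesis in print (searched 2026-08-21: held corpus,
keyword + vector, "double rounding division emin necessary" and a prose paraphrase of the claim;
galaxy, all corpora, "double rounding|innocuous double|twice the precision" — textbook and
Goldberg-1991-reprint hits only, none on the exponent range).  NEW here: `emin₂ ≤ emin₁ - p₁` is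
NECESSARY for every pair of records — `emin₂ = emin₁ - p₁ + 1`, indeed every `1 ≤ d ≤ p₁ - 1`,
fails whatever `p₂` — so the underflow clause of (Q) is the exact threshold, two below Table II's.
No hardware or vendor claims.
-/

namespace Summit.Ventures.CertifiedArithmetic

open Literature.ComputerArithmetic.FloatingPoint
open Literature.ComputerArithmetic.FloatingPoint.Format
open Literature.ComputerArithmetic.FloatingPoint.MiniFloat

/-! ## §1 THEOREM N-div-U -/

/-- THEOREM N-div-U, WITNESS (U1) (the underflow clause of (Q) is necessary — a quantum of `ψ` at
most `m_φ` binades finer is never innocuous for division, WHATEVER THE PRECISION of `ψ`), for EVERY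
pair of format records: `1 ≤ d = L_φ - L_ψ ≤ m` (`m = m_φ ≥ 1`), the data `a = 2^i` and
`b = (2^(m+1) - 1)·2^c` quanta of `φ` in range with `i = m + c + L_φ`, and `2^(d-1) ≤ M_ψ`
`⟹ ¬ DRDiv φ ψ`, by `a / b = 2^m·q/(2^(m+1) - 1) = (q/2)·(1 + 1/(2^(m+1) - 1))`:
`fl_ψ (a/b) = q/2 = 2^(d-1)·quantum ψ` (a value of `ψ`; the excess `(q/2)/(2^(m+1) - 1)` is below
`quantum ψ / 2` iff `2^d < 2^(m+1) - 1`), `fl_φ (q/2) = 0` (tie to even), `fl_φ (a/b) = q`.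
For `bias φ ≥ 1` the data are `a = q` (the least subnormal) and `b = 2 - 2^-m`.
[this packet; cite: Figueroa1995, §3; cite: Roux2014, §4] -/
theorem not_drDiv_of_underflow {φ ψ : Format} (hq : ψ.qexp + 1 ≤ φ.qexp)
    (hd : φ.qexp ≤ ψ.qexp + φ.manBits) (h1 : 1 ≤ φ.manBits) {i c : ℕ}
    (hi : (i : ℤ) = φ.manBits + c + φ.qexp) (ha : 2 ^ i ≤ φ.maxScaled)
    (hb : (2 ^ (φ.manBits + 1) - 1) * 2 ^ c ≤ φ.maxScaled)
    (hy : 2 ^ ((φ.qexp - ψ.qexp).toNat - 1) ≤ ψ.maxScaled) : ¬ DRDiv φ ψ := by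
  intro hD
  have hq0 := φ.quantum_pos
  have hq1 := ψ.quantum_pos
  have hm2 : 2 ≤ 2 ^ φ.manBits := le_trans (by norm_num) (Nat.pow_le_pow_right (by norm_num) h1)
  have hpow : 2 ^ (φ.manBits + 1) = 2 * 2 ^ φ.manBits := pow_succ' 2 _
  have hi1 : 1 ≤ 2 ^ i := Nat.one_le_two_pow
  set d := (φ.qexp - ψ.qexp).toNat with hd'
  have hd1 : 1 ≤ d := by omega
  have hdm : d ≤ φ.manBits := by omega
  have hQ : φ.quantum = 2 ^ d * ψ.quantum := quantum_eq_two_pow_mul (by omega)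
  have hd2 : (2 : ℚ) ^ d = 2 * 2 ^ (d - 1) := by
    rw [← pow_succ']; congr 1; omega
  -- data
  have haR : φ.Representable (2 ^ i) := by
    simpa using representable_mul_pow (φ := φ) (k := 1) (j := i) (by omega) (by simpa using ha)
  obtain ⟨a, ha'⟩ := exists_toRat_eq_natMul haR
  obtain ⟨b, hb'⟩ := exists_toRat_eq_natMul
    (representable_mul_pow (φ := φ) (k := 2 ^ (φ.manBits + 1) - 1) (j := c) (by omega) hb)
  have hN4 : (4 : ℚ) ≤ 2 ^ (φ.manBits + 1) := by
    exact_mod_cast (show 4 ≤ 2 ^ (φ.manBits + 1) by omega)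
  have hNpos : (0 : ℚ) < 2 ^ (φ.manBits + 1) - 1 := by linarith
  -- the quotient
  have hquot : a.toRat / b.toRat
      = φ.quantum / 2 + φ.quantum / 2 / (2 ^ (φ.manBits + 1) - 1) := by
    have hB : (((2 ^ (φ.manBits + 1) - 1) * 2 ^ c : ℕ) : ℚ)
        = (2 ^ (φ.manBits + 1) - 1) * 2 ^ c := by
      rw [Nat.cast_mul, Nat.cast_sub Nat.one_le_two_pow]; push_cast; ring
    rw [ha', hb', hB]
    push_cast
    rw [two_pow_eq_two_pow_mul_quantum (k := φ.manBits + c) (by push_cast; omega)]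
    have hNne : (2 : ℚ) ^ (φ.manBits + 1) - 1 ≠ 0 := hNpos.ne'
    field_simp
    ring
  -- the intermediate value `q/2 = 2^(d-1)·quantum ψ` on the grid of `ψ`
  have hμ : φ.quantum / 2 = ((2 ^ (d - 1) : ℕ) : ℚ) * ψ.quantum := by
    rw [hQ, hd2]; push_cast; ring
  have hY : (roundNE ψ (a.toRat / b.toRat)).toRat = φ.quantum / 2 := by
    rw [hquot, hμ]
    refine toRat_roundNE_natMul_add_small ?_ ?_
    · have h2 : 2 ^ (0 + 1) ≤ 2 ^ (ψ.manBits + 1) := Nat.pow_le_pow_right (by norm_num) (by omega)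
      simpa using representable_mul_pow (φ := ψ) (k := 1) (j := d - 1)
        (lt_of_lt_of_le (by norm_num) h2) (by simpa using hy)
    · rw [abs_of_pos (div_pos (by positivity) hNpos)]
      have h2d : (2 : ℚ) ^ d ≤ 2 ^ φ.manBits := pow_le_pow_right₀ (by norm_num) hdm
      have h2m : (2 : ℚ) ≤ 2 ^ φ.manBits := by exact_mod_cast hm2
      have hpowQ : (2 : ℚ) ^ (φ.manBits + 1) = 2 * 2 ^ φ.manBits := pow_succ' 2 _
      have e0 : 2 * (((2 ^ (d - 1) : ℕ) : ℚ) * ψ.quantum) = 2 ^ d * ψ.quantum := by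
        rw [hd2]; push_cast; ring
      rw [← mul_div_assoc, div_lt_iff₀ hNpos, e0, hpowQ]
      have e1 := mul_le_mul_of_nonneg_right h2d hq1.le
      have e2 := mul_le_mul_of_nonneg_right h2m hq1.le
      linarith
  -- the two roundings in `φ`
  have hX1 : (roundNE φ (φ.quantum / 2)).toRat = 0 := by
    have h := toRat_roundNE_half_of_even h1 (j := 0) ⟨0, rfl⟩ (by omega) (by omega)
    have e : φ.quantum / 2 = ((2 * 0 + 1 : ℕ) : ℚ) / 2 * φ.quantum := by push_cast; ring
    rw [e, h]; push_cast; ring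
  have hX2 : (roundNE φ (a.toRat / b.toRat)).toRat = φ.quantum := by
    rw [hquot]
    have hrep : φ.Representable 1 := representable_of_lt_pow (by omega) (by omega)
    have hlt : φ.quantum / 2 / (2 ^ (φ.manBits + 1) - 1) < φ.quantum / 2 :=
      div_lt_self (half_pos hq0) (by linarith)
    have hpos : 0 < φ.quantum / 2 / (2 ^ (φ.manBits + 1) - 1) := div_pos (half_pos hq0) hNpos
    have e : φ.quantum / 2 + φ.quantum / 2 / (2 ^ (φ.manBits + 1) - 1)
        = ((1 : ℕ) : ℚ) * φ.quantum
          + (φ.quantum / 2 / (2 ^ (φ.manBits + 1) - 1) - φ.quantum / 2) := by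
      push_cast; ring
    rw [e, toRat_roundNE_natMul_add_small hrep
      (by rw [abs_of_neg (by linarith), neg_sub]; linarith)]
    push_cast; ring
  have := hD a b
  rw [hY, hX1, hX2] at this
  linarith

/-- THEOREM N-div-U, WITNESS (U0) (any WIDER significand, quantum at most `m_φ - 1 - k` binades
finer), for EVERY pair of format records: `L_ψ ≤ L_φ`, `m + 1 ≤ m_ψ` (`m = m_φ`),
`k + d + 1 ≤ m` (`d = L_φ - L_ψ`), the data `a = 2^n` and `b = (2^(m+1) - 1)·2^c` quanta of `φ` in
range with `n = 2m + 2 + k + c + L_φ`, the window `2^(m+1+k) + 2^(k+1) ≤ M_φ` and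
`(2^(m+1) + 1)·2^(k+d) ≤ M_ψ` `⟹ ¬ DRDiv φ ψ`, by Figueroa's quotient
`a / b = (2^(m+1+k) + 2^k + 2^k/(2^(m+1) - 1))·q_φ` of THEOREM N-div-S: the midpoint
`y = (2^(m+1+k) + 2^k)·q_φ = (2^(m+1) + 1)·2^(k+d)·q_ψ` is a value of `ψ` and the excess
`2^(k+d)·q_ψ/(2^(m+1) - 1)` is below `q_ψ / 2`, so `fl_ψ (a/b) = y ↦ 2^(m+1+k)·q_φ` (tie to even),
directly `(2^(m+1+k) + 2^(k+1))·q_φ`.  (N-div-S needed `y` normal in `ψ` and `m_ψ ≤ 2m`; here the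
integrality of the grid of `ψ` replaces both.) [this packet; cite: Figueroa1995, §3] -/
theorem not_drDiv_of_underflow_low {φ ψ : Format} (hq : ψ.qexp ≤ φ.qexp)
    (hlo : φ.manBits + 1 ≤ ψ.manBits) {k c n : ℕ}
    (hkd : k + (φ.qexp - ψ.qexp).toNat + 1 ≤ φ.manBits)
    (hn : (n : ℤ) = 2 * φ.manBits + 2 + k + c + φ.qexp) (ha : 2 ^ n ≤ φ.maxScaled)
    (hb : (2 ^ (φ.manBits + 1) - 1) * 2 ^ c ≤ φ.maxScaled)
    (hu : 2 ^ (φ.manBits + 1 + k) + 2 ^ (k + 1) ≤ φ.maxScaled)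
    (hy : (2 ^ (φ.manBits + 1) + 1) * 2 ^ (k + (φ.qexp - ψ.qexp).toNat) ≤ ψ.maxScaled) :
    ¬ DRDiv φ ψ := by
  intro hD
  have hq0 := φ.quantum_pos
  have hq1 := ψ.quantum_pos
  have h1 : 1 ≤ φ.manBits := by omega
  have hm2 : 2 ≤ 2 ^ φ.manBits := le_trans (by norm_num) (Nat.pow_le_pow_right (by norm_num) h1)
  have hpow : 2 ^ (φ.manBits + 1) = 2 * 2 ^ φ.manBits := pow_succ' 2 _
  set d := (φ.qexp - ψ.qexp).toNat with hd
  have hQ : φ.quantum = 2 ^ d * ψ.quantum := quantum_eq_two_pow_mul hq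
  -- data
  have haR : φ.Representable (2 ^ n) := by
    simpa using representable_mul_pow (φ := φ) (k := 1) (j := n) (by omega) (by simpa using ha)
  obtain ⟨a, ha'⟩ := exists_toRat_eq_natMul haR
  obtain ⟨b, hb'⟩ := exists_toRat_eq_natMul
    (representable_mul_pow (φ := φ) (k := 2 ^ (φ.manBits + 1) - 1) (j := c) (by omega) hb)
  have hN4 : (4 : ℚ) ≤ 2 ^ (φ.manBits + 1) := by
    exact_mod_cast (show 4 ≤ 2 ^ (φ.manBits + 1) by omega)
  have hNpos : (0 : ℚ) < 2 ^ (φ.manBits + 1) - 1 := by linarith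
  -- the quotient
  have hquot : a.toRat / b.toRat = ((2 ^ (φ.manBits + 1 + k) + 2 ^ k : ℕ) : ℚ) * φ.quantum
      + 2 ^ k * φ.quantum / (2 ^ (φ.manBits + 1) - 1) := by
    have hB : (((2 ^ (φ.manBits + 1) - 1) * 2 ^ c : ℕ) : ℚ)
        = (2 ^ (φ.manBits + 1) - 1) * 2 ^ c := by
      rw [Nat.cast_mul, Nat.cast_sub Nat.one_le_two_pow]; push_cast; ring
    rw [ha', hb', hB]
    push_cast
    rw [two_pow_eq_two_pow_mul_quantum (k := 2 * φ.manBits + 2 + k + c) (by push_cast; omega)]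
    have hNne : (2 : ℚ) ^ (φ.manBits + 1) - 1 ≠ 0 := hNpos.ne'
    field_simp
    ring
  -- the intermediate value `y = (2^(m+1+k) + 2^k)·q_φ = (2^(m+1) + 1)·2^(k+d)·q_ψ` is a value of ψ
  have hyv : ((2 ^ (φ.manBits + 1 + k) + 2 ^ k : ℕ) : ℚ) * φ.quantum
      = (((2 ^ (φ.manBits + 1) + 1) * 2 ^ (k + d) : ℕ) : ℚ) * ψ.quantum := by
    rw [hQ]; push_cast; ring
  have hY : (roundNE ψ (a.toRat / b.toRat)).toRat
      = ((2 ^ (φ.manBits + 1 + k) + 2 ^ k : ℕ) : ℚ) * φ.quantum := by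
    rw [hquot, hyv]
    refine toRat_roundNE_natMul_add_small (representable_mul_pow ?_ hy) ?_
    · have h2 : 2 ^ (φ.manBits + 1 + 1) ≤ 2 ^ (ψ.manBits + 1) :=
        Nat.pow_le_pow_right (by norm_num) (by omega)
      rw [pow_succ] at h2
      omega
    · rw [abs_of_pos (div_pos (by positivity) hNpos)]
      have hkd' : (2 : ℚ) ^ (k + d + 1) ≤ 2 ^ φ.manBits := pow_le_pow_right₀ (by norm_num) hkd
      have h2m : (2 : ℚ) ≤ 2 ^ φ.manBits := by exact_mod_cast hm2
      have hpowQ : (2 : ℚ) ^ (φ.manBits + 1) = 2 * 2 ^ φ.manBits := pow_succ' 2 _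
      have e0 : 2 * (2 ^ k * φ.quantum) = 2 ^ (k + d + 1) * ψ.quantum := by rw [hQ]; ring
      rw [← mul_div_assoc, div_lt_iff₀ hNpos, e0, hpowQ]
      have e1 := mul_le_mul_of_nonneg_right hkd' hq1.le
      have e2 := mul_le_mul_of_nonneg_right h2m hq1.le
      linarith
  -- the two roundings in `φ`
  have hX1 := toRat_roundNE_midpoint h1 hu
  have hX2 : (roundNE φ (a.toRat / b.toRat)).toRat
      = ((2 ^ (φ.manBits + 1 + k) + 2 ^ (k + 1) : ℕ) : ℚ) * φ.quantum := by
    rw [hquot]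
    have hδ : (0 : ℚ) < 2 ^ k * φ.quantum / (2 ^ (φ.manBits + 1) - 1) :=
      div_pos (by positivity) hNpos
    have hδ' : 2 ^ k * φ.quantum / (2 ^ (φ.manBits + 1) - 1) ≤ 2 ^ k * φ.quantum :=
      div_le_self (by positivity) (by linarith)
    have e2 : ((2 ^ (φ.manBits + 1 + k) + 2 ^ (k + 1) : ℕ) : ℚ) * φ.quantum
        = ((2 ^ (φ.manBits + 1 + k) + 2 ^ k : ℕ) : ℚ) * φ.quantum + 2 ^ k * φ.quantum := by
      push_cast; ring
    exact toRat_roundNE_of_gt_midpoint hu (by linarith) (by rw [e2]; linarith)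
  have := hD a b
  rw [hY, hX1, hX2] at this
  push_cast at this
  have h2 : (0 : ℚ) < 2 ^ (k + 1) * φ.quantum := by positivity
  have := mul_right_cancel₀ hq0.ne' this
  linarith

/-! ## §2 The hypotheses as boolean tests; the named records -/

/-- THE HYPOTHESIS OF (U1) AS A BOOLEAN TEST on parameter records, with the canonical exponents
`c = max (0, -(m_X + L_X))` (the divisor an integer number of quanta) and `i = m_X + c + L_X`.
[this packet] -/
def drDivUnderflowTest (X Y : Format) : Bool :=
  let d := (X.qexp - Y.qexp).toNat
  let c := (-((X.manBits : ℤ) + X.qexp)).toNat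
  let i := ((X.manBits : ℤ) + c + X.qexp).toNat
  decide (Y.qexp + 1 ≤ X.qexp) && decide (X.qexp ≤ Y.qexp + X.manBits) &&
  decide (1 ≤ X.manBits) && decide (2 ^ i ≤ X.maxScaled) &&
  decide ((2 ^ (X.manBits + 1) - 1) * 2 ^ c ≤ X.maxScaled) && decide (2 ^ (d - 1) ≤ Y.maxScaled)

/-- SOUNDNESS OF THE TEST: `drDivUnderflowTest X Y ⟹ ¬ DRDiv X Y` ((U1) at the canonical
exponents). [this packet] -/
theorem not_drDiv_of_underflowTest {X Y : Format} (h : drDivUnderflowTest X Y = true) :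
    ¬ DRDiv X Y := by
  simp only [drDivUnderflowTest, Bool.and_eq_true, decide_eq_true_eq] at h
  obtain ⟨⟨⟨⟨⟨hq, hd⟩, h1⟩, ha⟩, hb⟩, hy⟩ := h
  exact not_drDiv_of_underflow hq hd h1 (by omega) ha hb hy

/-- THE HYPOTHESIS OF (U0) AT `k = 0` AS A BOOLEAN TEST on parameter records, with the canonical
exponents `c = max (0, -(2 m_X + 2 + L_X))` and `n = 2 m_X + 2 + c + L_X`. [this packet] -/
def drDivUnderflowLowTest (X Y : Format) : Bool :=
  let d := (X.qexp - Y.qexp).toNat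
  let c := (-(2 * (X.manBits : ℤ) + 2 + X.qexp)).toNat
  let n := (2 * (X.manBits : ℤ) + 2 + c + X.qexp).toNat
  decide (Y.qexp ≤ X.qexp) && decide (X.manBits + 1 ≤ Y.manBits) && decide (d + 1 ≤ X.manBits) &&
  decide (2 ^ n ≤ X.maxScaled) && decide ((2 ^ (X.manBits + 1) - 1) * 2 ^ c ≤ X.maxScaled) &&
  decide (2 ^ (X.manBits + 1) + 2 ≤ X.maxScaled) &&
  decide ((2 ^ (X.manBits + 1) + 1) * 2 ^ d ≤ Y.maxScaled)

/-- SOUNDNESS OF THE TEST: `drDivUnderflowLowTest X Y ⟹ ¬ DRDiv X Y` ((U0) at `k = 0` and the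
canonical exponents). [this packet] -/
theorem not_drDiv_of_underflowLowTest {X Y : Format} (h : drDivUnderflowLowTest X Y = true) :
    ¬ DRDiv X Y := by
  simp only [drDivUnderflowLowTest, Bool.and_eq_true, decide_eq_true_eq] at h
  obtain ⟨⟨⟨⟨⟨⟨hq, hlo⟩, hkd⟩, ha⟩, hb⟩, hu⟩, hy⟩ := h
  exact not_drDiv_of_underflow_low (k := 0) hq hlo (by omega) (by omega) ha hb (by simpa using hu)
    (by simpa using hy)

/-- ON THE NAMED `13 × 13` MATRIX the test (U1) holds on exactly `8` cells: the embedded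
e5m2 → binary8p3f (`d = 1 ≤ m = 2`) and `7` non-embedded pairs with a slightly finer quantum
(`d ∈ {1, 2, 3}`). [this packet] -/
theorem drDivUnderflow_named_iff : ∀ X ∈ namedFormats, ∀ Y ∈ namedFormats,
    drDivUnderflowTest X Y = true ↔
    (X, Y) ∈ [(E2M3, E3M2), (E4M3, Binary8p4), (E4M3, Binary8p4F), (E5M2, Binary8p3),
      (E5M2, Binary8p3F), (Binary8p5, E4M3), (Binary8p5, Binary8p4), (Binary8p5, Binary8p4F)] := by
  decide +kernel

/-- NO NAMED PAIR satisfies the hypothesis of (U0) at `k = 0` (a wider significand never comes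
with `d ≤ m - 1` among the `13` records). [this packet] -/
theorem drDivUnderflowLow_named : ∀ X ∈ namedFormats, ∀ Y ∈ namedFormats,
    drDivUnderflowLowTest X Y = false := by
  decide +kernel

/-- THE `8` CELLS OF (U1) FAIL BY THE LAW: e2m3 → e3m2 (`1/8 ÷ 15/8 = 1/15 ↦ 1/16 ↦ 0`, directly
`1/8`), e4m3 → binary8p4 / binary8p4f and binary8p5 → e4m3 / binary8p4 / binary8p4f
(`2^L ÷ (2 - 2^-m)`), e5m2 → binary8p3 / binary8p3f (`2^-16 ÷ 7/4 ↦ 2^-17 ↦ 0`, directly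
`2^-16`); only e5m2 → binary8p3f is an embedded pair. [this packet] -/
theorem drDivUnderflow_cells : ∀ p ∈ [(E2M3, E3M2), (E4M3, Binary8p4), (E4M3, Binary8p4F),
    (E5M2, Binary8p3), (E5M2, Binary8p3F), (Binary8p5, E4M3), (Binary8p5, Binary8p4),
    (Binary8p5, Binary8p4F)],
    ¬ DRDiv p.1 p.2 ∧ (embedsTest p.1 p.2 = true ↔ p = (E5M2, Binary8p3F)) := by
  intro p hp
  simp only [List.mem_cons, List.not_mem_nil, or_false] at hp
  rcases hp with rfl | rfl | rfl | rfl | rfl | rfl | rfl | rfl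
  all_goals exact ⟨not_drDiv_of_underflowTest (by decide +kernel), by decide +kernel⟩

end Summit.Ventures.CertifiedArithmetic
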